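import Literature.Probability.LatticeModels.WeightTable
import Literature.Probability.RandomPlanarGeometry.HopfClosed
import Literature.Topology.PlaneTopology.RectilinearLoops
import HarnessLib

/-!
# The Umlaufsatz for cycles of the turning rule (`medialCycle_turning`, T2 of the s-holomorphicity programme)

Topic `Literature/Probability/LatticeModels`. This file discharges the named fact
`medialCycle_turning` of `WeightTable.lean` — for every bond configuration `β` of `ℤ²` and every
cycle of the successor map `nextCorner β` of minimal period `Q` through a corner `q`, the signed
number of quarter turns `∑_{m<Q} turnSign β (orb m)` is `4` or `-4` — and with it (next file,
`FKInterfacePairingProofs.lean`, through `isSHolomorphic_fkIsingObservable_of_zdArcA_connected_of_turning`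
of `MedialCycleSeparation.lean`) the corrected node 1 of crit-ising.S18, Smirnov's
s-holomorphicity of the critical FK-Ising observable for a connected wired arc.

The proof transports the cycle to a closed self-avoiding walk on `ℤ²` and applies the discrete
Hopf Umlaufsatz `SAW.Hopf.hopf_closed` (`RandomPlanarGeometry/HopfClosed.lean`):

* the corner `(v, k)` is coded by the lattice point `RectLoop.code (v, k) = 2v + w_k`
  (`Topology/PlaneTopology/RectilinearLoops.lean`; the affine image of the point
  `v + (u_k + u_{k+1})/4` at which Smirnov rounds the medial loop, Ann. Math. 172 (2010), §4,
  Fig. 5); `code` is injective (`code_injective`) and one step of the turning rule moves the code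
  by a unit vector: `dir (k + 1)` along an open edge, `dir (k + 2)` across a closed one
  (`code_nextCorner_of_mem`, `code_nextCorner_of_not_mem`);
* embedded in `ℂ` (`x ↦ x₁ + i x₂`), two consecutive steps turn by the exterior angle
  `(π/4) (turnSign p + turnSign (next p)) ∈ {0, ± π/2}` (`toReal_argDiff_steps`): the coded walk
  goes straight where the medial loop alternates left/right and turns by `± π/2` where two equal
  turns follow each other, so its total turning is `(π/2) ∑ turnSign`;
* on a cycle of minimal period the corners, hence the codes, are pairwise distinct, and on `ℤ²`
  an edge `[P, P + d]` of a walk is seen from every other lattice point `R` under an angle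
  `< π/2` (`dot_pos`: `|A|² + A·d > 0` for `A = P - R ∈ ℤ² ∖ {0, -d}`) — the hypothesis of
  `hopf_closed`, applied with the base point at a lowest vertex of the cycle.

Hence `(π/2) ∑_{m<Q} turnSign = ± 2π` (`medialCycle_turning_holds`). No definition is introduced
(the embedding `ℤ² → ℂ` is written out as `x ↦ (x.1 + x.2 * I : ℂ)`); H. Hopf, Compositio Math. 2
(1935), Satz I, is the source of the statement, the lattice discretisation is that of
`HexSAWHopf.lean` (`hopf_open`, `HV.subtended_pos` for the honeycomb lattice).
-/

noncomputable section

namespace Literature.Probability.LatticeModels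

open Complex Finset Literature.Topology.PlaneTopology
open Literature.Probability.RandomPlanarGeometry.SAW.Hopf

/-! ### The embedding `ℤ² → ℂ` -/

/-- The embedding is additive: differences go to differences. [folklore] -/
theorem embZ2_sub (P R : ℤ × ℤ) : (P.1 + P.2 * I : ℂ) - (R.1 + R.2 * I : ℂ) = ((P - R).1 + (P - R).2 * I : ℂ) := by
  simp only [Prod.fst_sub, Prod.snd_sub]; push_cast; ring

/-- The real inner product of two embedded lattice vectors is their dot product. [folklore] -/
theorem embZ2_mul_conj_re (P R : ℤ × ℤ) : ((P.1 + P.2 * I : ℂ) * (starRingEnd ℂ) ((R.1 + R.2 * I : ℂ))).re = P.1 * R.1 + P.2 * R.2 := by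
  simp [Complex.mul_re]

/-- The imaginary part of an embedded lattice point is its second coordinate. [folklore] -/
theorem embZ2_im (P : ℤ × ℤ) : ((P.1 + P.2 * I : ℂ)).im = P.2 := by simp

/-- The embedding is injective. [folklore] -/
theorem embZ2_injective {P R : ℤ × ℤ} (h : (P.1 + P.2 * I : ℂ) = (R.1 + R.2 * I : ℂ)) : P = R := by
  have h1 := congrArg Complex.re h
  have h2 := congrArg Complex.im h
  simp at h1 h2
  exact Prod.ext (by exact_mod_cast h1) (by exact_mod_cast h2)

/-- The four unit vectors go to the powers of `i`: `dir k ↦ i ^ k`. [folklore] -/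
theorem embZ2_dir (k : Fin 4) : ((RectLoop.dir k).1 + (RectLoop.dir k).2 * I : ℂ) = I ^ (k : ℕ) := by
  fin_cases k <;> apply Complex.ext <;> simp [RectLoop.dir, pow_succ]

/-! ### Lattice geometry: the subtended-angle bound on `ℤ²` -/

/-- `(a + 1) a + b² > 0` for `(a, b) ∉ {(0, 0), (-1, 0)}`. [folklore] -/
private theorem dot_pos_aux (a b : ℤ) (h0 : ¬ (a = 0 ∧ b = 0)) (h1 : ¬ (a + 1 = 0 ∧ b = 0)) :
    0 < (a + 1) * a + b * b := by
  by_cases hb : b = 0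
  · subst hb
    have ha : 1 ≤ a ∨ a ≤ -2 := by omega
    rcases ha with ha | ha <;> nlinarith
  · have hb2 : 1 ≤ b * b := (Int.lt_iff_add_one_le).1 (mul_self_pos.2 hb)
    nlinarith [sq_nonneg (2 * a + 1)]

/-- **The subtended-angle bound on `ℤ²`.** A unit edge `[P, P + d]` is seen from every lattice
point `R ∉ {P, P + d}` under an angle `< π/2`: with `A = P - R`, `(A + d) · A = |A|² + d · A > 0`.
[folklore] -/
theorem dot_pos {A : ℤ × ℤ} (k : Fin 4) (h0 : A ≠ 0) (h1 : A + RectLoop.dir k ≠ 0) :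
    0 < (A + RectLoop.dir k).1 * A.1 + (A + RectLoop.dir k).2 * A.2 := by
  obtain ⟨a, b⟩ := A
  simp only [ne_eq, Prod.ext_iff, Prod.fst_zero, Prod.snd_zero, Prod.fst_add, Prod.snd_add] at h0 h1
  fin_cases k <;> simp only [RectLoop.dir, Prod.fst_add, Prod.snd_add] at h1 ⊢
  · have := dot_pos_aux a b h0 (by omega); nlinarith
  · have := dot_pos_aux b a (by omega) (by omega); nlinarith
  · have := dot_pos_aux (-a) b (by omega) (by omega); nlinarith
  · have := dot_pos_aux (-b) a (by omega) (by omega); nlinarith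

/-! ### The corner code along the turning rule -/

/-- **The corner code is injective**: `2v + w_k` determines `(v, k)` (the offsets `w_k` are the
four residues modulo `2`). [folklore] -/
theorem code_injective : Function.Injective RectLoop.code := by
  rintro ⟨v, k⟩ ⟨v', k'⟩ h
  simp only [RectLoop.code, Prod.ext_iff, Prod.smul_mk, smul_eq_mul, Prod.fst_add, Prod.snd_add] at h
  obtain ⟨h1, h2⟩ := h
  fin_cases k <;> fin_cases k' <;> simp only [RectLoop.codeOff] at h1 h2 <;>
    first
    | (exfalso; omega)
    | (refine Prod.ext (funext fun i => ?_) rfl; fin_cases i <;> simp <;> omega)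

variable {β : Percolation.BondConfig (Site 2)}

/-- **Following an open edge moves the code by `dir (k + 1)`**: from `(v, k)` to
`(v + u_{k+1}, k + 3)`. [folklore] -/
theorem code_nextCorner_of_mem {p : Site 2 × Fin 4} (h : cTgt p ∈ β) :
    RectLoop.code (nextCorner β p) = RectLoop.code p + RectLoop.dir (p.2 + 1) := by
  obtain ⟨v, k⟩ := p
  rw [nextCorner_of_mem h]
  fin_cases k <;> simp [RectLoop.code, RectLoop.codeOff, RectLoop.dir, cornerUnit, Prod.ext_iff] <;> omega

/-- **Crossing a closed edge moves the code by `dir (k + 2)`**: from `(v, k)` to `(v, k + 1)`.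
[folklore] -/
theorem code_nextCorner_of_not_mem {p : Site 2 × Fin 4} (h : cTgt p ∉ β) :
    RectLoop.code (nextCorner β p) = RectLoop.code p + RectLoop.dir (p.2 + 2) := by
  obtain ⟨v, k⟩ := p
  rw [nextCorner_of_not_mem h]
  fin_cases k <;> simp [RectLoop.code, RectLoop.codeOff, RectLoop.dir]

/-- Every step of the turning rule moves the code by a unit vector. [folklore] -/
theorem exists_code_nextCorner (p : Site 2 × Fin 4) :
    ∃ k : Fin 4, RectLoop.code (nextCorner β p) = RectLoop.code p + RectLoop.dir k := by
  by_cases h : cTgt p ∈ β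
  · exact ⟨_, code_nextCorner_of_mem h⟩
  · exact ⟨_, code_nextCorner_of_not_mem h⟩

/-! ### The exterior angles of the coded walk -/

/-- `i ^ (k + 2) = -i ^ k` with `k + 2` taken in `Fin 4`. [folklore] -/
theorem I_pow_fin_add_two (k : Fin 4) : I ^ ((k + 2 : Fin 4) : ℕ) = -I ^ (k : ℕ) := by
  fin_cases k <;> simp [pow_succ]

/-- `i ^ (k + 3) = -(i ^ k · i)` with `k + 3` taken in `Fin 4`. [folklore] -/
theorem I_pow_fin_add_three (k : Fin 4) : I ^ ((k + 3 : Fin 4) : ℕ) = -(I ^ (k : ℕ) * I) := by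
  fin_cases k <;> simp [pow_succ]

/-- The exterior angle between `w` and `c w` is `arg c`. [folklore] -/
theorem toReal_argDiff_mul_left {c w : ℂ} (hc : c ≠ 0) (hw : w ≠ 0) :
    ((Complex.arg (c * w) : Real.Angle) - (Complex.arg w : Real.Angle)).toReal = Complex.arg c := by
  rw [Complex.arg_mul_coe_angle hc hw, add_sub_cancel_right, Complex.arg_coe_angle_toReal_eq_arg]

/-- The embedded step of the turning rule along an open edge: `i^k · i`. [folklore] -/
theorem embCode_nextCorner_sub_of_mem {p : Site 2 × Fin 4} (h : cTgt p ∈ β) :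
    ((RectLoop.code (nextCorner β p)).1 + (RectLoop.code (nextCorner β p)).2 * I : ℂ) -
      ((RectLoop.code p).1 + (RectLoop.code p).2 * I : ℂ) = I ^ (p.2 : ℕ) * I := by
  rw [embZ2_sub, code_nextCorner_of_mem h, add_sub_cancel_left, embZ2_dir, I_pow_fin_succ]

/-- The embedded step of the turning rule across a closed edge: `-i^k`. [folklore] -/
theorem embCode_nextCorner_sub_of_not_mem {p : Site 2 × Fin 4} (h : cTgt p ∉ β) :
    ((RectLoop.code (nextCorner β p)).1 + (RectLoop.code (nextCorner β p)).2 * I : ℂ) -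
      ((RectLoop.code p).1 + (RectLoop.code p).2 * I : ℂ) = -I ^ (p.2 : ℕ) := by
  rw [embZ2_sub, code_nextCorner_of_not_mem h, add_sub_cancel_left, embZ2_dir, I_pow_fin_add_two]

/-- **The coded walk turns by `(π/4)(turnSign p + turnSign (next p))`.** Two consecutive steps of
the turning rule move the code straight on if the two turns differ (left/right or right/left),
by a left quarter turn if both cross closed edges, by a right quarter turn if both follow open
edges. [cite: Smirnov2010, §4 Fig. 5] -/
theorem toReal_argDiff_steps (p : Site 2 × Fin 4) :
    ((Complex.arg
        (((RectLoop.code (nextCorner β (nextCorner β p))).1 + (RectLoop.code (nextCorner β (nextCorner β p))).2 * I : ℂ) -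
          ((RectLoop.code (nextCorner β p)).1 + (RectLoop.code (nextCorner β p)).2 * I : ℂ)) : Real.Angle) -
      (Complex.arg
        (((RectLoop.code (nextCorner β p)).1 + (RectLoop.code (nextCorner β p)).2 * I : ℂ) -
          ((RectLoop.code p).1 + (RectLoop.code p).2 * I : ℂ)) : Real.Angle)).toReal =
      Real.pi / 4 * (turnSign β p + turnSign β (nextCorner β p)) := by
  have hIk : I ^ (p.2 : ℕ) ≠ 0 := pow_ne_zero _ I_ne_zero
  by_cases h1 : cTgt p ∈ β
  · have hk : (nextCorner β p).2 = p.2 + 3 := by rw [nextCorner_of_mem h1]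
    have hw : I ^ (p.2 : ℕ) * I ≠ 0 := mul_ne_zero hIk I_ne_zero
    rw [embCode_nextCorner_sub_of_mem h1, turnSign_of_mem h1]
    by_cases h2 : cTgt (nextCorner β p) ∈ β
    · -- open, open: a right quarter turn
      rw [embCode_nextCorner_sub_of_mem h2, turnSign_of_mem h2, hk, I_pow_fin_add_three,
        show -(I ^ (p.2 : ℕ) * I) * I = (-I) * (I ^ (p.2 : ℕ) * I) by ring,
        toReal_argDiff_mul_left (neg_ne_zero.2 I_ne_zero) hw, Complex.arg_neg_I]
      push_cast; ring
    · -- open, closed: straight on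
      rw [embCode_nextCorner_sub_of_not_mem h2, turnSign_of_not_mem h2, hk, I_pow_fin_add_three, neg_neg,
        sub_self, Real.Angle.toReal_zero]
      push_cast; ring
  · have hk : (nextCorner β p).2 = p.2 + 1 := by rw [nextCorner_of_not_mem h1]
    have hw : -I ^ (p.2 : ℕ) ≠ 0 := neg_ne_zero.2 hIk
    rw [embCode_nextCorner_sub_of_not_mem h1, turnSign_of_not_mem h1]
    by_cases h2 : cTgt (nextCorner β p) ∈ β
    · -- closed, open: straight on
      rw [embCode_nextCorner_sub_of_mem h2, turnSign_of_mem h2, hk, I_pow_fin_succ,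
        show I ^ (p.2 : ℕ) * I * I = -I ^ (p.2 : ℕ) by rw [mul_assoc, I_mul_I]; ring,
        sub_self, Real.Angle.toReal_zero]
      push_cast; ring
    · -- closed, closed: a left quarter turn
      rw [embCode_nextCorner_sub_of_not_mem h2, turnSign_of_not_mem h2, hk, I_pow_fin_succ,
        show -(I ^ (p.2 : ℕ) * I) = I * (-I ^ (p.2 : ℕ)) by ring,
        toReal_argDiff_mul_left I_ne_zero hw, Complex.arg_I]
      push_cast; ring

/-! ### Cycles of minimal period -/

/-- Sums over a period of a periodic sequence are shift-invariant (local copy for `ℤ`-valued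
sequences; general forms live in unrelated corners of the tree, e.g.
`NumberTheory.LFunctions.Tao2016.sum_range_periodic_add`, not imported here). [folklore] -/
private theorem sum_range_shift_of_periodic {f : ℕ → ℤ} {Q : ℕ} (hf : ∀ m, f (m + Q) = f m) (a : ℕ) :
    ∑ m ∈ range Q, f (a + m) = ∑ m ∈ range Q, f m := by
  induction a with
  | zero => simp
  | succ a ih =>
    rw [← ih]
    have h1 : ∑ m ∈ range (Q + 1), f (a + m) = ∑ m ∈ range Q, f (a + m) + f (a + Q) := sum_range_succ _ _
    have h2 : ∑ m ∈ range (Q + 1), f (a + m) = ∑ m ∈ range Q, f (a + (m + 1)) + f (a + 0) := sum_range_succ' _ _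
    rw [hf] at h1
    rw [add_zero] at h2
    have : ∑ m ∈ range Q, f (a + (m + 1)) = ∑ m ∈ range Q, f (a + m) := by linarith
    rw [← this]
    refine sum_congr rfl fun m _ => ?_
    congr 1; omega

/-- **On a cycle of minimal period `Q`, any `Q` consecutive corners are distinct.**
[cite: Smirnov2001, §2] -/
theorem cornerOrbit_window_injective {q : Site 2 × Fin 4} {Q : ℕ} (hmin : ∀ s, 0 < s → s < Q → cornerOrbit β q s ≠ q)
    (a : ℕ) {i j : ℕ} (hi : i < Q) (hj : j < Q) (h : cornerOrbit β q (a + i) = cornerOrbit β q (a + j)) : i = j := by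
  wlog hij : i ≤ j generalizing i j
  · exact (this hj hi h.symm (not_le.mp hij).le).symm
  have key : cornerOrbit β q (0 + (a + i)) = cornerOrbit β q ((j - i) + (a + i)) := by
    rw [zero_add, show j - i + (a + i) = a + j by omega]; exact h
  have h0 := cornerOrbit_eq_of_add_eq q (a + i) key
  by_contra hne
  exact hmin (j - i) (by omega) (by omega) h0.symm

/-! ### The Umlaufsatz -/

/-- **T2: the Umlaufsatz for cycles of the turning rule** (`medialCycle_turning` of
`WeightTable.lean`; H. Hopf, Compositio Math. 2 (1935), Satz I, for the rounded medial loops of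
Smirnov, Ann. Math. 172 (2010), §4, Fig. 5). For every bond configuration `β` of `ℤ²` and every
cycle of `nextCorner β` of minimal period `Q` through `q`, `∑_{m<Q} turnSign β (orb m) = ±4`.
Proof: the coded cycle is a closed self-avoiding unit-step walk on `ℤ²` turning by
`(π/4)(turnSign p + turnSign (next p))` at each vertex; by the discrete Hopf Umlaufsatz
`hopf_closed` (base point at a lowest vertex, subtended angles `< π/2` by `dot_pos`) its total
turning `(π/2) ∑ turnSign` is `± 2π`. [cite: Hopf1935, Satz I] -/
theorem medialCycle_turning_holds : medialCycle_turning := by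
  intro β q Q hQ0 hQ hmin
  classical
  -- notation and periodicity
  set orb := cornerOrbit β q with horb
  have hper : ∀ m, orb (m + Q) = orb m := fun m => cornerOrbit_add_period hQ m
  -- the lowest vertex of the coded cycle
  obtain ⟨m₀, hm₀, hlow⟩ := exists_min_image (range Q) (fun m => (RectLoop.code (orb m)).2)
    ⟨0, mem_range.2 hQ0⟩
  rw [mem_range] at hm₀
  set z : ℕ → ℂ := fun m => ((RectLoop.code (orb (m₀ + m))).1 + (RectLoop.code (orb (m₀ + m))).2 * I : ℂ) with hz
  have hzsucc : ∀ m, orb (m₀ + (m + 1)) = nextCorner β (orb (m₀ + m)) := fun m => rfl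
  -- the hypotheses of `hopf_closed`
  have hstep : ∀ m, ∃ k : Fin 4, RectLoop.code (orb (m₀ + (m + 1))) = RectLoop.code (orb (m₀ + m)) + RectLoop.dir k :=
    fun m => by rw [hzsucc]; exact exists_code_nextCorner _
  have hzQ : z Q = z 0 := by simp only [hz, add_zero, hper]
  have hzQ1 : z (Q + 1) = z 1 := by
    simp only [hz]; rw [show m₀ + (Q + 1) = (m₀ + 1) + Q by omega, hper]
  have hinj : ∀ i j : ℕ, i < Q → j < Q → z i = z j → i = j := by
    intro i j hi hj h
    exact cornerOrbit_window_injective hmin m₀ hi hj (code_injective (embZ2_injective h))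
  have hsub : ∀ k j : ℕ, k < Q → j < Q → z j ≠ z k → z j ≠ z (k + 1) →
      0 < ((z (k + 1) - z j) * (starRingEnd ℂ) (z k - z j)).re := by
    intro k j hk hj h1 h2
    obtain ⟨d, hd⟩ := hstep k
    simp only [hz] at h1 h2 ⊢
    rw [hd, embZ2_sub, embZ2_sub, embZ2_mul_conj_re, show RectLoop.code (orb (m₀ + k)) + RectLoop.dir d -
      RectLoop.code (orb (m₀ + j)) = (RectLoop.code (orb (m₀ + k)) - RectLoop.code (orb (m₀ + j))) + RectLoop.dir d by abel]
    have := dot_pos (A := RectLoop.code (orb (m₀ + k)) - RectLoop.code (orb (m₀ + j))) d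
      (fun h0 => h1 (by rw [(sub_eq_zero.1 h0)]))
      (fun h0 => h2 (by rw [hd, ← sub_eq_zero, embZ2_sub]; simp [show RectLoop.code (orb (m₀ + j)) -
        (RectLoop.code (orb (m₀ + k)) + RectLoop.dir d) = -((RectLoop.code (orb (m₀ + k)) -
          RectLoop.code (orb (m₀ + j))) + RectLoop.dir d) by abel, h0]))
    exact_mod_cast this
  have hbot : ∀ j < Q, 0 ≤ (z j - z 0).im := by
    intro j hj
    simp only [hz, add_zero]
    rw [embZ2_sub, embZ2_im, Prod.snd_sub]
    have h1 : orb (m₀ + j) = orb ((m₀ + j) % Q) := (cornerOrbit_mod_period hQ _).symm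
    have h2 := hlow ((m₀ + j) % Q) (mem_range.2 (Nat.mod_lt _ hQ0))
    rw [← h1] at h2
    push_cast
    linarith [(Int.cast_le (R := ℝ)).2 h2]
  -- the period is at least `3`
  have hE : ∀ v, ((Complex.arg (z (v + 2) - z (v + 1)) : Real.Angle) - (Complex.arg (z (v + 1) - z v) : Real.Angle)).toReal =
      Real.pi / 4 * (turnSign β (orb (m₀ + v)) + turnSign β (orb (m₀ + (v + 1)))) := by
    intro v
    simp only [hz]
    rw [show m₀ + (v + 2) = m₀ + (v + 1) + 1 by omega]
    exact toReal_argDiff_steps (orb (m₀ + v))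
  have hQ3 : 3 ≤ Q := by
    by_contra hlt
    have hQ12 : Q = 1 ∨ Q = 2 := by omega
    rcases hQ12 with rfl | rfl
    · obtain ⟨d, hd⟩ := hstep 0
      have h10 : z 1 = z 0 := hzQ
      simp only [hz, add_zero] at h10 hd
      rw [hd] at h10
      have := embZ2_injective h10
      have hd0 : RectLoop.dir d = 0 := by simpa using this
      revert hd0; fin_cases d <;> simp [RectLoop.dir]
    · have h20 : z 2 = z 0 := hzQ
      have hE0 := hE 0
      rw [show (0 : ℕ) + 2 = 2 from rfl, show (0 : ℕ) + 1 = 1 from rfl, h20] at hE0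
      have hne : z 1 - z 0 ≠ 0 := by
        intro h0
        have := hinj 1 0 (by omega) (by omega) (sub_eq_zero.1 h0)
        omega
      rw [show z 0 - z 1 = (-1) * (z 1 - z 0) by ring, toReal_argDiff_mul_left (by norm_num) hne,
        Complex.arg_neg_one] at hE0
      -- `π = (π/4)(s + s')` with `s, s' ∈ {±1}` is impossible
      have hs : ∀ p : Site 2 × Fin 4, turnSign β p = 1 ∨ turnSign β p = -1 := by
        intro p; by_cases hp : cTgt p ∈ β
        · exact Or.inr (turnSign_of_mem hp)
        · exact Or.inl (turnSign_of_not_mem hp)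
      rcases hs (orb (m₀ + 0)) with h | h <;> rcases hs (orb (m₀ + (0 + 1))) with h' | h' <;>
        rw [h, h'] at hE0 <;> push_cast at hE0 <;> linarith [Real.pi_pos]
  -- Hopf
  have hhopf := hopf_closed z hQ3 hzQ hzQ1 hinj hsub hbot
  -- the total turning is `(π/2) ∑ turnSign`
  have hper' : ∀ m, turnSign β (orb (m + Q)) = turnSign β (orb m) := fun m => by rw [hper]
  have hsum : ∑ v ∈ range Q, ((Complex.arg (z (v + 2) - z (v + 1)) : Real.Angle) -
      (Complex.arg (z (v + 1) - z v) : Real.Angle)).toReal =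
      Real.pi / 2 * ((∑ m ∈ range Q, turnSign β (orb m) : ℤ) : ℝ) := by
    simp_rw [hE]
    rw [← mul_sum, sum_add_distrib]
    have h1 : ∑ v ∈ range Q, (turnSign β (orb (m₀ + v)) : ℝ) = ((∑ m ∈ range Q, turnSign β (orb m) : ℤ) : ℝ) := by
      rw [← sum_range_shift_of_periodic hper' m₀]; push_cast; rfl
    have h2 : ∑ v ∈ range Q, (turnSign β (orb (m₀ + (v + 1))) : ℝ) = ((∑ m ∈ range Q, turnSign β (orb m) : ℤ) : ℝ) := by
      rw [← sum_range_shift_of_periodic hper' (m₀ + 1)]; push_cast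
      refine sum_congr rfl fun v _ => ?_
      rw [show m₀ + (v + 1) = m₀ + 1 + v by omega]
    rw [h1, h2]; ring
  rw [hsum] at hhopf
  have hπ : Real.pi / 2 ≠ 0 := by positivity
  rcases hhopf with h | h
  · left
    have h' : Real.pi / 2 * ((∑ m ∈ range Q, turnSign β (orb m) : ℤ) : ℝ) = Real.pi / 2 * 4 := by rw [h]; ring
    exact_mod_cast mul_left_cancel₀ hπ h'
  · right
    have h' : Real.pi / 2 * ((∑ m ∈ range Q, turnSign β (orb m) : ℤ) : ℝ) = Real.pi / 2 * (-4) := by rw [h]; ring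
    exact_mod_cast mul_left_cancel₀ hπ h'

end Literature.Probability.LatticeModels
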